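import Mathlib
import Summits.RiemannHypothesis.RiemannHypothesis.Theorems.WeilFarFloorResidualDirection
import Summits.RiemannHypothesis.RiemannHypothesis.Theorems.WeilFarFloorResidualEnergy
import Summits.RiemannHypothesis.RiemannHypothesis.Theorems.WeilFarFloorCoshQuotientLowerRH
import HarnessLib

/-!
# The second-order law of the floor gap, LOWER half (under RH)

Helper file (`--supports stmt-RiemannHypothesis-0098`, lead-track anchor: Weil-positivity window ladder, format-C far bound),
pure proofs.  Seat rh-explicit-weil-1 gen15 (memo `run/shared/lean/pub/rh-explicit/rh-explicit-weil-1/FORMAT-K3.md` §16.4).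

★ `farCoercivityFloor_ge_coshQuotient_add_secondOrder_of_RH`: under RH, for every `ε > 0`, eventually in `a`,
**`λ_max(a) ≥ R_c(a) + (1 − ε)·J(a)/R_c(a) − ε·e^{−a}`**, `R_c(a) = Q_a(C_a)/(a + sinh a)` the cosh quotient and
`J(a) = ∫_{(−a,a)}(T_aC_a − R_c(a)C_a)²/(a + sinh a)` the residual energy of the cosh profile — the matching lower half of
`WeilFarFloorSecondOrderLawRH.farCoercivityFloor_le_coshQuotient_add_secondOrder_of_RH` (`λ_max ≤ R_c + (1+ε)J/R_c + εe^{−a}`),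
so that TOGETHER: `λ_max(a) = R_c(a) + (1 + o(1))·J(a)/R_c(a) + o(e^{−a})` — the coefficient of the gap is the residual energy.

Proof: the test `u = C_a + v/R_c` with `v` the smoothed truncated residual of `WeilFarFloorResidualDirection` at the scales
`σ = e^{−6a}`, `θ = e^{−2a}`, `θ' = e^{−3a}`, `W = 76e^a`; its zero energy is `Re Q_W(v) ≤ Z₁‖v‖² + Z₀` with `Z₁ = O(a³)` by the
Plancherel/Gallagher bound `FloorZeroEnergy.weilQuadratic_re_le_of_quadraticModulus_of_RH` (`T₀ = 2M + M₁ + 1 ≤ (6K+4)e^{20a}`), the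
residual energy is `ρ ≤ Ka⁵(a + sinh a)` (`residualEnergy_le_of_RH`) and `R_c(a) ≥ e^a/2` (`coshQuotient_ge_of_RH`); the abstract
Rayleigh step is `farCoercivityFloor_sub_coshQuotient_ge_of_direction` with `η = min(ε,1)/3`; every threshold is an instance of
`(a³+1)e^{−a} → 0` (one `maxHeartbeats 400000` for the long bookkeeping proof).  Standard axioms only.
-/

set_option linter.dupNamespace false
set_option autoImplicit false

noncomputable section

open MeasureTheory Set Filter
open scoped Real Topology ArithmeticFunction.vonMangoldt

namespace Summit.RiemannHypothesis.RiemannHypothesis.Theorems.WeilFormatC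

namespace FloorSecondOrder

open Literature.NumberTheory.LFunctions FloorCosh FloorCoshSplit FloorZeroEnergy

set_option maxHeartbeats 400000 in -- one long bookkeeping proof over a large context (named scales and budgets)
/-- ★★★ **THE SECOND-ORDER LAW, LOWER HALF (under RH).**  For every `ε > 0`, eventually in `a`:
`R_c(a) + (1 − ε)·J(a)/R_c(a) − ε·e^{−a} ≤ λ_max(a)`, where `R_c(a) = Q_a(C_a)/(a + sinh a)` is the cosh quotient and
`J(a) = (∫_{(−a,a)} (T_aC_a − R_c(a)C_a)²)/(a + sinh a)` the residual energy of the cosh profile `C_a = 1_{[−a,a]}cosh(·/2)`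
under the prime-shift operator `(T_af)(x) = Σ_{log n < 2a} (Λ(n)/√n)(f(x − log n) + f(x + log n))`. -/
theorem farCoercivityFloor_ge_coshQuotient_add_secondOrder_of_RH (hRH : RiemannHypothesis) {ε : ℝ} (hε : 0 < ε) :
    ∃ a₀ : ℝ, ∀ a : ℝ, a₀ ≤ a →
      primeShiftForm a ((Icc (-a) a).indicator (fun y ↦ Real.cosh (y / 2))) / (a + Real.sinh a)
          + (1 - ε)
            * ((∫ x in Ioo (-a) a,
                ((∑ n ∈ weilPrimeIndex a, (Λ n : ℝ) / Real.sqrt n *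
                    ((Icc (-a) a).indicator (fun y ↦ Real.cosh (y / 2)) (x - Real.log n)
                      + (Icc (-a) a).indicator (fun y ↦ Real.cosh (y / 2)) (x + Real.log n)))
                  - primeShiftForm a ((Icc (-a) a).indicator (fun y ↦ Real.cosh (y / 2))) / (a + Real.sinh a)
                    * (Icc (-a) a).indicator (fun y ↦ Real.cosh (y / 2)) x) ^ 2) / (a + Real.sinh a))
            / (primeShiftForm a ((Icc (-a) a).indicator (fun y ↦ Real.cosh (y / 2))) / (a + Real.sinh a))
          - ε * Real.exp (-a)
        ≤ farCoercivityFloor a := by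
  classical
  obtain ⟨Cq, hCq0, hRlow⟩ := coshQuotient_ge_of_RH hRH
  obtain ⟨K₆, hK₆0, hρle⟩ := residualEnergy_le_of_RH hRH
  obtain ⟨Cz, hCz0, hZall⟩ := weilQuadratic_re_le_affine_of_RH
  /- ─── constants ─── -/
  have hI0 : 0 ≤ ∫ t in Ioi (0 : ℝ), (Real.exp (t / 2) - 1) / (2 * Real.sinh t) :=
    setIntegral_nonneg measurableSet_Ioi fun t ht ↦ weilKillingDensity_nonneg ht
  have hL0 : 0 ≤ Real.log (4 * π) + Real.eulerMascheroniConstant := by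
    have h2 : 0 ≤ Real.log (4 * π) := Real.log_nonneg (by linarith only [Real.pi_gt_three])
    linarith only [h2, Real.one_half_lt_eulerMascheroniConstant]
  set K := 2 * (∫ t in Ioi (0 : ℝ), (Real.exp (t / 2) - 1) / (2 * Real.sinh t))
    + (Real.log (4 * π) + Real.eulerMascheroniConstant) with hKdef
  have hK0 : 0 ≤ K := by rw [hKdef]; linarith only [hI0, hL0]
  set L₀ := Real.log (6 * K₆ + 4) with hL₀
  have hL₀0 : 0 ≤ L₀ := Real.log_nonneg (by linarith only [hK₆0])
  set B₁ := K + 24 * Cz * (L₀ + 21) with hB₁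
  have hB₁0 : 0 ≤ B₁ := by rw [hB₁]; positivity
  -- `ε' = min ε 1`, `η = ε'/3`
  set ε' := min ε 1 with hε'
  have hε'0 : 0 < ε' := lt_min hε one_pos
  have hε'1 : ε' ≤ 1 := min_le_right _ _
  have hε'ε : ε' ≤ ε := min_le_left _ _
  set η := ε' / 3 with hη
  have hη0 : 0 < η := by rw [hη]; positivity
  have hη3 : 3 * η = ε' := by rw [hη]; ring
  have hη1 : η ≤ 1 := by rw [hη]; linarith only [hε'1]
  -- the master constant `c = η/(10⁸ S)`
  set S := Cq + K₆ + Cz + B₁ + 1 with hS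
  have hS1 : 1 ≤ S := by rw [hS]; linarith only [hCq0, hK₆0, hCz0, hB₁0]
  have hS0 : 0 < S := by linarith only [hS1]
  set c := η / (10 ^ 8 * S) with hc
  have hc0 : 0 < c := by rw [hc]; positivity
  have hCqc : Cq * c ≤ η / 10 ^ 8 := mul_master_le hη0.le (by rw [hS]; linarith only [hK₆0, hCz0, hB₁0]) hS0
  have hK₆c : K₆ * c ≤ η / 10 ^ 8 := mul_master_le hη0.le (by rw [hS]; linarith only [hCq0, hCz0, hB₁0]) hS0
  have hCzc : Cz * c ≤ η / 10 ^ 8 := mul_master_le hη0.le (by rw [hS]; linarith only [hCq0, hK₆0, hB₁0]) hS0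
  have hB₁c : B₁ * c ≤ η / 10 ^ 8 := mul_master_le hη0.le (by rw [hS]; linarith only [hCq0, hK₆0, hCz0]) hS0
  have hc8 : c ≤ η / 10 ^ 8 := by
    have h := mul_master_le hη0.le hS1 hS0
    rw [one_mul] at h; exact h
  have hη8 : η / 10 ^ 8 ≤ 1 / 10 ^ 8 := div_le_div_of_nonneg_right hη1 (by norm_num)
  have hc1 : c ≤ 1 := by linarith only [hc8, hη8]
  /- ─── master smallness `(a³+1)e^{−a} → 0` ─── -/
  have hΦ : Tendsto (fun a : ℝ ↦ (a ^ 3 + 1) * Real.exp (-a)) atTop (𝓝 0) := by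
    have h := (Real.tendsto_pow_mul_exp_neg_atTop_nhds_zero 3).add Real.tendsto_exp_neg_atTop_nhds_zero
    rw [add_zero] at h
    exact h.congr' (Eventually.of_forall fun a ↦ by ring)
  obtain ⟨a₁, ha₁⟩ := Filter.eventually_atTop.1 (hΦ.eventually (Iio_mem_nhds hc0))
  refine ⟨max a₁ 4, fun a ha ↦ ?_⟩
  have ha4 : 4 ≤ a := le_trans (le_max_right _ _) ha
  have ha1 : 1 ≤ a := by linarith only [ha4]
  have ha0 : 0 < a := by linarith only [ha4]
  have hct : (a ^ 3 + 1) * Real.exp (-a) < c := ha₁ a (le_trans (le_max_left _ _) ha)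
  /- ─── scales (explicit) and `R ≥ e^a/2` ─── -/
  have hXt : Real.exp a * Real.exp (-a) = 1 := by rw [← Real.exp_add]; simp
  have hX1 : 1 ≤ Real.exp a := Real.one_le_exp (by linarith only [ha4])
  have ht1 : Real.exp (-a) ≤ 1 := Real.exp_le_one_iff.2 (by linarith only [ha4])
  have ha31 : (1 : ℝ) ≤ a ^ 3 + 1 := by have := pow_nonneg ha0.le 3; linarith only [this]
  have htc : Real.exp (-a) < c := lt_of_le_of_lt (le_mul_of_one_le_left (Real.exp_pos _).le ha31) hct
  have hP0' : 0 < a + Real.sinh a := by have := Real.sinh_pos_iff.2 ha0; linarith only [this, ha0]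
  have hRlo := hRlow a ha1
  have hCqX : Cq * (a ^ 3 + 1) ≤ Real.exp a / 2 := by
    have h1 : Cq * (a ^ 3 + 1) = Cq * ((a ^ 3 + 1) * Real.exp (-a)) * Real.exp a := by
      calc Cq * (a ^ 3 + 1) = Cq * (a ^ 3 + 1) * (Real.exp a * Real.exp (-a)) := by rw [hXt, mul_one]
        _ = _ := by ring
    rw [h1]
    have h2 : Cq * ((a ^ 3 + 1) * Real.exp (-a)) ≤ Cq * c := mul_le_mul_of_nonneg_left hct.le hCq0
    have h3 : Cq * c ≤ 1 / 2 := by linarith only [hCqc, hη8]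
    nlinarith only [h2, h3, Real.exp_pos a]
  have hRX' : Real.exp a / 2
      ≤ primeShiftForm a ((Icc (-a) a).indicator (fun y ↦ Real.cosh (y / 2))) / (a + Real.sinh a) := by
    linarith only [hRlo, hCqX]
  have hR0' : 0 < primeShiftForm a ((Icc (-a) a).indicator (fun y ↦ Real.cosh (y / 2))) / (a + Real.sinh a) := by
    linarith only [hRX', Real.exp_pos a]
  have hWsum : ∑ n ∈ weilPrimeIndex a, 2 * ((Λ n : ℝ) / Real.sqrt n) ≤ 76 * Real.exp a :=
    (weightSum_le a).trans (by linarith only [hX1])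
  have hσ0 : 0 < Real.exp (-a) ^ 6 := by positivity
  have hσ1 : Real.exp (-a) ^ 6 ≤ 1 / 4 := by
    have h1 : Real.exp (-a) ^ 6 ≤ Real.exp (-a) := pow_le_of_le_one (Real.exp_pos _).le ht1 (by norm_num)
    linarith only [h1, htc, hc8, hη8]
  /- ─── the direction ─── -/
  obtain ⟨v, hv, hvT, hvρ, hEC, hEF, hS, hmod, hmodx, hx2⟩ :=
    exists_residualDirection (a := a) (θ := Real.exp (-a) ^ 2) (θ' := Real.exp (-a) ^ 3) ha1 hWsum hR0'.le hσ0 hσ1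
      (by positivity) (by positivity)
  have hρK := hρle a ha1
  /- ─── names ─── -/
  obtain ⟨hCm, hCb, hCs⟩ := coshTest_admissible a
  set X := Real.exp a with hX
  set t := Real.exp (-a) with ht
  set P := a + Real.sinh a with hP
  set C : ℝ → ℝ := (Icc (-a) a).indicator (fun y ↦ Real.cosh (y / 2)) with hCdef
  set R := primeShiftForm a C / P with hR
  set F : ℝ → ℝ := fun x ↦ ∑ n ∈ weilPrimeIndex a, (Λ n : ℝ) / Real.sqrt n * (C (x - Real.log n) + C (x + Real.log n))
    with hFdef
  have hFx : ∀ x, F x = ∑ n ∈ weilPrimeIndex a, (Λ n : ℝ) / Real.sqrt n * (C (x - Real.log n) + C (x + Real.log n)) :=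
    fun x ↦ rfl
  simp only [← hFx] at hvρ hEF hmod hmodx hρK ⊢
  set G : ℝ → ℝ := fun x ↦ F x - R * C x with hGdef
  have hGx : ∀ x, G x = F x - R * C x := fun x ↦ rfl
  simp only [← hGx] at hvρ hEF hmod hmodx hρK ⊢
  set ρ := ∫ x in Ioo (-a) a, G x ^ 2 with hρdef
  set Nv := ∫ x, v x ^ 2 with hNv
  /- ─── basic inequalities ─── -/
  have hX0 : 0 < X := Real.exp_pos _
  have ht0 : 0 < t := Real.exp_pos _
  have haX : a + 1 ≤ X := by rw [hX]; exact Real.add_one_le_exp a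
  have haX' : a ≤ X := by linarith only [haX]
  have hP0 : 0 < P := hP0'
  have hPX : P ≤ X := by
    have h1 : a ≤ Real.sinh a := Real.self_le_sinh_iff.2 ha0.le
    have h2 : Real.sinh a < Real.cosh a := Real.sinh_lt_cosh a
    have h3 : Real.cosh a + Real.sinh a = X := by rw [hX]; exact Real.cosh_add_sinh a
    rw [hP]; linarith only [h1, h2, h3]
  have hXP : X / 2 ≤ P := by
    have h1 : Real.sinh a = (X - t) / 2 := by rw [Real.sinh_eq, hX, ht]
    rw [hP, h1]; linarith only [ht1, ha1]
  have hRX : X / 2 ≤ R := hRX'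
  have hR0 : 0 < R := hR0'
  have hρ0 : 0 ≤ ρ := setIntegral_nonneg measurableSet_Ioo fun x _ ↦ sq_nonneg _
  have hNv0 : 0 ≤ Nv := integral_nonneg fun x ↦ sq_nonneg _
  have hNx0 : 0 ≤ ∫ x, x ^ 2 * v x ^ 2 := integral_nonneg fun x ↦ by positivity
  have ht8 : t ≤ 1 / 10 ^ 8 := by linarith only [htc, hc8, hη8]
  have ht3 : t ^ 3 ≤ t := pow_le_of_le_one ht0.le ht1 (by norm_num)
  /- ─── the budgets in numbers: `E_C, S ≤ 10⁶t`, `E_F ≤ 10⁶` ─── -/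
  obtain ⟨hEC1, hEF1, hSb1⟩ := lowerHalf_budgets_le hXt ht0 ht1 hPX
  set EC := 8 * (76 * X) * X * t ^ 6 + (t ^ 2 * P + 224 * (76 * X) ^ 2 * X * t ^ 6 / t ^ 2) / 2 with hECdef
  set EF := 8 * (76 * X) ^ 2 * X * t ^ 6 + (t ^ 3 * ((76 * X) ^ 2 * P) + 224 * (76 * X) ^ 2 * X * t ^ 6 / t ^ 3) / 2
    with hEFdef
  set Sb := (t ^ 2 * P + 224 * (76 * X) ^ 2 * X * t ^ 6 / t ^ 2) / 2 with hSbdef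
  have hSb0 : 0 ≤ Sb := by rw [hSbdef]; positivity
  have hEC0 : 0 ≤ EC := by rw [hECdef]; positivity
  have hEF0 : 0 ≤ EF := by rw [hEFdef]; positivity
  /- ─── the zero energy of the direction ─── -/
  have hσX : (t ^ 6) ^ 2 * X ^ 12 = 1 := by
    calc (t ^ 6) ^ 2 * X ^ 12 = (X * t) ^ 12 := by ring
      _ = 1 := by rw [hXt]; ring
  set M := ρ / (t ^ 6) ^ 2 with hMdef
  set M₁ := 2 * (a + 1) ^ 2 * M + 2 * ρ with hM₁def
  have hM0 : 0 ≤ M := by rw [hMdef]; positivity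
  have hM₁0 : 0 ≤ M₁ := by rw [hM₁def]; positivity
  have hh₀ : 0 < min (2 * t ^ 6) 1 := lt_min (by positivity) one_pos
  have hZv := hZall hv hRH hh₀ hM0 hM₁0 hmod hmodx hx2
  set T₀ := 2 * M + M₁ + 1 with hT₀
  have hT₀1 : 1 ≤ T₀ := by rw [hT₀]; linarith only [hM0, hM₁0]
  have eT : 2 * M + M₁ + 4 = T₀ + 3 := by rw [hT₀]; ring
  rw [eT] at hZv
  -- `T₀ + 3 ≤ (6K₆ + 4)X²⁰`, so `log(T₀ + 3) ≤ L₀ + 20a`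
  have ha5 : a ^ 5 ≤ X ^ 5 := pow_le_pow_left₀ ha0.le haX' 5
  have hρX : ρ ≤ K₆ * X ^ 6 := hρK.trans (by
    calc K₆ * a ^ 5 * P ≤ K₆ * X ^ 5 * X := mul_le_mul (mul_le_mul_of_nonneg_left ha5 hK₆0.le) hPX hP0.le (by positivity)
      _ = K₆ * X ^ 6 := by ring)
  have hMle : M ≤ K₆ * X ^ 18 := by
    have hMeq : M = ρ * X ^ 12 := by
      rw [hMdef, div_eq_iff (by positivity)]
      calc ρ = ρ * ((t ^ 6) ^ 2 * X ^ 12) := by rw [hσX, mul_one]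
        _ = ρ * X ^ 12 * (t ^ 6) ^ 2 := by ring
    rw [hMeq]
    calc ρ * X ^ 12 ≤ K₆ * X ^ 6 * X ^ 12 := mul_le_mul_of_nonneg_right hρX (by positivity)
      _ = K₆ * X ^ 18 := by ring
  have hX20 : ∀ k : ℕ, k ≤ 20 → X ^ k ≤ X ^ 20 := fun k hk ↦ pow_le_pow_right₀ hX1 hk
  have hT3 : T₀ + 3 ≤ (6 * K₆ + 4) * X ^ 20 := by
    have h1 : (a + 1) ^ 2 ≤ X ^ 2 := pow_le_pow_left₀ (by linarith only [ha0]) haX 2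
    have h2 : (a + 1) ^ 2 * M ≤ X ^ 2 * (K₆ * X ^ 18) := mul_le_mul h1 hMle hM0 (by positivity)
    have h2' : X ^ 2 * (K₆ * X ^ 18) = K₆ * X ^ 20 := by ring
    have h3 : ρ ≤ K₆ * X ^ 20 := hρX.trans (mul_le_mul_of_nonneg_left (hX20 6 (by norm_num)) hK₆0.le)
    have h4 : M ≤ K₆ * X ^ 20 := hMle.trans (mul_le_mul_of_nonneg_left (hX20 18 (by norm_num)) hK₆0.le)
    have h5 : (1 : ℝ) ≤ X ^ 20 := one_le_pow₀ hX1
    rw [hT₀, hM₁def]; linarith only [h2, h2', h3, h4, h5]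
  have hlog : Real.log (T₀ + 3) ≤ L₀ + 20 * a := by
    have h1 : Real.log (T₀ + 3) ≤ Real.log ((6 * K₆ + 4) * X ^ 20) :=
      Real.log_le_log (by linarith only [hT₀1]) hT3
    have h2 : Real.log ((6 * K₆ + 4) * X ^ 20) = L₀ + 20 * a := by
      rw [Real.log_mul (by positivity) (by positivity), Real.log_pow, hX, Real.log_exp, hL₀]; push_cast; ring
    linarith only [h1, h2]
  have hlog0 : 0 ≤ Real.log (T₀ + 3) := Real.log_nonneg (by linarith only [hT₀1])
  set ℓ := Real.log (T₀ + 3) with hℓ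
  set Z₁ := Cz * (2 * π) * ((ℓ + 1 / 2) * (2 + a ^ 2)) with hZ₁
  set Z₀ := Cz * (2 * π) with hZ₀
  have hZ₁0 : 0 ≤ Z₁ := by rw [hZ₁]; positivity
  have hZ₀0 : 0 ≤ Z₀ := by rw [hZ₀]; positivity
  have hZ' : (weilQuadratic fun x ↦ (v x : ℂ)).re ≤ Z₁ * Nv + Z₀ := hZv
  -- `K + Z₁ ≤ B₁(a³ + 1)`
  have hZ₁le : Z₁ ≤ 24 * Cz * (L₀ + 21) * a ^ 3 := by
    have h1 : ℓ + 1 / 2 ≤ (L₀ + 21) * a := by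
      have := mul_nonneg hL₀0 (by linarith only [ha1] : (0 : ℝ) ≤ a - 1)
      linarith only [hlog, this, ha1]
    have h2 : 2 + a ^ 2 ≤ 3 * a ^ 2 := by nlinarith only [ha1]
    have h3 : (ℓ + 1 / 2) * (2 + a ^ 2) ≤ ((L₀ + 21) * a) * (3 * a ^ 2) :=
      mul_le_mul h1 h2 (by positivity) (by positivity)
    have hπ : 2 * π ≤ 2 * 4 := by linarith only [Real.pi_le_four]
    rw [hZ₁]
    calc Cz * (2 * π) * ((ℓ + 1 / 2) * (2 + a ^ 2)) ≤ Cz * (2 * 4) * (((L₀ + 21) * a) * (3 * a ^ 2)) :=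
          mul_le_mul (mul_le_mul_of_nonneg_left hπ hCz0.le) h3 (by positivity) (by positivity)
      _ = 24 * Cz * (L₀ + 21) * a ^ 3 := by ring
  have hQ₁' : K + Z₁ ≤ B₁ * (a ^ 3 + 1) := by
    have h1 : K ≤ K * (a ^ 3 + 1) := le_mul_of_one_le_right hK0 ha31
    have h2 : 24 * Cz * (L₀ + 21) * a ^ 3 ≤ 24 * Cz * (L₀ + 21) * (a ^ 3 + 1) :=
      mul_le_mul_of_nonneg_left (by linarith only) (by positivity)
    rw [hB₁]; linarith only [hZ₁le, h1, h2]
  /- ─── the three smallness conditions ─── -/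
  have hQ₁ : K + Z₁ ≤ η * R := by
    have h1 : B₁ * (a ^ 3 + 1) = B₁ * ((a ^ 3 + 1) * t) * X := by
      calc B₁ * (a ^ 3 + 1) = B₁ * (a ^ 3 + 1) * (X * t) := by rw [hXt, mul_one]
        _ = _ := by ring
    have h2 : B₁ * ((a ^ 3 + 1) * t) ≤ B₁ * c := mul_le_mul_of_nonneg_left hct.le hB₁0
    have h3 : B₁ * ((a ^ 3 + 1) * t) * X ≤ (η / 10 ^ 8) * X := mul_le_mul_of_nonneg_right (h2.trans hB₁c) hX0.le
    have h4 : (η / 10 ^ 8) * X ≤ η * (X / 2) := by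
      have := mul_pos hη0 hX0; linarith only [this]
    have h5 : η * (X / 2) ≤ η * R := mul_le_mul_of_nonneg_left hRX hη0.le
    linarith only [hQ₁', h1, h3, h4, h5]
  have hX2R : X ^ 2 / 4 ≤ R ^ 2 := by
    have := pow_le_pow_left₀ (by positivity) hRX 2
    calc X ^ 2 / 4 = (X / 2) ^ 2 := by ring
      _ ≤ R ^ 2 := this
  have hρR : ρ ≤ η * (R ^ 2 * P) := by
    have h1 : a ^ 5 * t ^ 2 ≤ ((a ^ 3 + 1) * t) ^ 2 := by
      have : a ^ 5 ≤ (a ^ 3 + 1) ^ 2 :=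
        calc a ^ 5 ≤ a ^ 6 := pow_le_pow_right₀ ha1 (by norm_num)
          _ ≤ (a ^ 3 + 1) ^ 2 := by have := pow_nonneg ha0.le 3; nlinarith only [this]
      nlinarith only [this, sq_nonneg t]
    have h2 : ((a ^ 3 + 1) * t) ^ 2 ≤ c ^ 2 := pow_le_pow_left₀ (by positivity) hct.le 2
    have h3 : c ^ 2 ≤ c := by nlinarith only [hc0, hc1]
    have h4 : K₆ * (a ^ 5 * t ^ 2) ≤ η / 10 ^ 8 :=
      calc K₆ * (a ^ 5 * t ^ 2) ≤ K₆ * c := mul_le_mul_of_nonneg_left ((h1.trans h2).trans h3) hK₆0.le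
        _ ≤ η / 10 ^ 8 := hK₆c
    have h5 : K₆ * a ^ 5 * P = K₆ * (a ^ 5 * t ^ 2) * X ^ 2 * P := by
      calc K₆ * a ^ 5 * P = K₆ * a ^ 5 * P * (X * t) ^ 2 := by rw [hXt]; ring
        _ = _ := by ring
    have h6 : K₆ * (a ^ 5 * t ^ 2) * X ^ 2 * P ≤ (η / 10 ^ 8) * X ^ 2 * P :=
      mul_le_mul_of_nonneg_right (mul_le_mul_of_nonneg_right h4 (sq_nonneg X)) hP0.le
    have h9 : (η / 10 ^ 8) * X ^ 2 ≤ η * (X ^ 2 / 4) := by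
      have := mul_pos hη0 (pow_pos hX0 2); linarith only [this]
    have h10 : η * (X ^ 2 / 4) ≤ η * R ^ 2 := mul_le_mul_of_nonneg_left hX2R hη0.le
    have h11 := mul_le_mul_of_nonneg_right (h9.trans h10) hP0.le
    calc ρ ≤ K₆ * a ^ 5 * P := hρK
      _ = _ := h5
      _ ≤ (η / 10 ^ 8) * X ^ 2 * P := h6
      _ ≤ η * R ^ 2 * P := h11
      _ = η * (R ^ 2 * P) := by ring
  have hECR : 2 * EC ≤ η * (R * P) := by
    have h1 : 2 * EC ≤ 2 * 10 ^ 6 * t := by linarith only [hEC1]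
    have h2 : 2 * 10 ^ 6 * t = 2 * 10 ^ 6 * t ^ 3 * X ^ 2 := by
      calc 2 * 10 ^ 6 * t = 2 * 10 ^ 6 * t * (X * t) ^ 2 := by rw [hXt]; ring
        _ = _ := by ring
    have h3 : 2 * 10 ^ 6 * t ^ 3 ≤ η / 4 := by linarith only [ht3, htc, hc8, hη0]
    have h4 : 2 * 10 ^ 6 * t ^ 3 * X ^ 2 ≤ (η / 4) * X ^ 2 := mul_le_mul_of_nonneg_right h3 (sq_nonneg X)
    have h5 : (η / 4) * X ^ 2 ≤ η * (R * P) := by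
      have h6 : X / 2 * (X / 2) ≤ R * P := mul_le_mul hRX hXP (by positivity) hR0.le
      have h7 := mul_le_mul_of_nonneg_left h6 hη0.le
      linarith only [h7]
    linarith only [h1, h2, h4, h5]
  /- ─── the abstract lower bound ─── -/
  have hmain₀ := farCoercivityFloor_sub_coshQuotient_ge_of_direction (a := a) ha0 hv hvT hρ0 hEC0 hEF0 hZ₁0 hZ₀0
    hη0.le hR0 hvρ hEC hEF hS hZ' hQ₁ hρR hECR
  have hmain : (1 - 3 * η) * (ρ / P) / R - (2 * EF / R + (Z₀ + 2 * Sb ^ 2) / R ^ 2 + 2 * EC) / P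
      ≤ farCoercivityFloor a - R := hmain₀
  /- ─── the error is `≤ ε·e^{−a}` ─── -/
  have hERR : (2 * EF / R + (Z₀ + 2 * Sb ^ 2) / R ^ 2 + 2 * EC) / P ≤ ε * t := by
    have h1 : 2 * EF / R ≤ 4 * 10 ^ 6 * t := by
      rw [div_le_iff₀ hR0]
      have h2 : 2 * EF ≤ 2 * 10 ^ 6 * (X * t) := by rw [hXt]; linarith only [hEF1]
      have h3 := mul_le_mul_of_nonneg_left (by linarith only [hRX] : X ≤ 2 * R) (by positivity : (0 : ℝ) ≤ 2 * 10 ^ 6 * t)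
      linarith only [h2, h3]
    have h2 : (Z₀ + 2 * Sb ^ 2) / R ^ 2 ≤ 2 * t := by
      rw [div_le_iff₀ (by positivity)]
      have hz : Z₀ ≤ X / 4 := by
        have h3 : Cz * t ≤ η / 10 ^ 8 := (mul_le_mul_of_nonneg_left htc.le hCz0.le).trans hCzc
        have h4 : Cz = Cz * t * X := by rw [mul_assoc, mul_comm t, hXt, mul_one]
        have h5 : Cz ≤ η / 10 ^ 8 * X := by rw [h4]; exact mul_le_mul_of_nonneg_right h3 hX0.le
        have h6 : η * X ≤ X := mul_le_of_le_one_left hX0.le hη1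
        have hπ := Real.pi_le_four
        have h7 : Cz * (2 * π) ≤ Cz * 8 := mul_le_mul_of_nonneg_left (by linarith only [hπ]) hCz0.le
        rw [hZ₀]; linarith only [h5, h6, h7, hX0]
      have hs : 2 * Sb ^ 2 ≤ X / 4 := by
        have h4 : Sb ^ 2 ≤ (10 ^ 6 * t) ^ 2 := pow_le_pow_left₀ hSb0 hSb1 2
        have h5 : t ^ 2 ≤ t / 10 ^ 8 := by nlinarith only [ht8, ht0]
        have h7 : t ≤ X / 10 ^ 8 := ht8.trans (div_le_div_of_nonneg_right hX1 (by norm_num))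
        linarith only [h4, h5, h7, hX0]
      have h8 : X / 2 ≤ 2 * t * R ^ 2 := by
        have e : t * X ^ 2 = X := by
          calc t * X ^ 2 = (X * t) * X := by ring
            _ = X := by rw [hXt, one_mul]
        have := mul_le_mul_of_nonneg_left hX2R (by positivity : (0 : ℝ) ≤ 2 * t)
        linarith only [this, e]
      linarith only [hz, hs, h8]
    have h3 : 2 * EC ≤ 2 * 10 ^ 6 * t := by linarith only [hEC1]
    rw [div_le_iff₀ hP0]
    have h4 : 7 * 10 ^ 6 * t ≤ ε * t * P := by
      have e : t * X = 1 := by rw [mul_comm]; exact hXt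
      have h6 : 10 ^ 8 ≤ η * X := by
        have := mul_le_mul_of_nonneg_right (htc.le.trans hc8) hX0.le
        linarith only [this, e]
      have h7 : η * X ≤ ε * X / 3 := by
        have := mul_le_mul_of_nonneg_right hε'ε hX0.le
        rw [hη]; linarith only [this]
      have h8 : ε * (X / 2) ≤ ε * P := mul_le_mul_of_nonneg_left hXP hε.le
      have h9 : 7 * 10 ^ 6 ≤ ε * P := by linarith only [h6, h7, h8]
      have := mul_le_mul_of_nonneg_left h9 ht0.le
      linarith only [this]
    linarith only [h1, h2, h3, h4, ht0]
  /- ─── assembly ─── -/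
  have hcoef : (1 - ε) * (ρ / P) / R ≤ (1 - 3 * η) * (ρ / P) / R := by
    rw [hη3]
    exact div_le_div_of_nonneg_right (mul_le_mul_of_nonneg_right (by linarith only [hε'ε]) (by positivity)) hR0.le
  linarith only [hmain, hERR, hcoef]

end FloorSecondOrder

end Summit.RiemannHypothesis.RiemannHypothesis.Theorems.WeilFormatC
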